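import Mathlib
import HarnessLib
import Literature.MathematicalPhysics.QuantumLattice.DWaveOrderParameterProofs
import Summits.HubbardSuperconductivity.HubbardSuperconductivity.Theorems.WeakCouplingBCSWcbcsBcsConstructionHamiltonianNormBound
import Summits.HubbardSuperconductivity.HubbardSuperconductivity.Theorems.WeakCouplingBCSWcbcsBcsConstructionDoubleCommutatorBound
import Summits.HubbardSuperconductivity.HubbardSuperconductivity.Theorems.WeakCouplingBCSWcbcsBcsConstructionTrialStateBound
import Summits.HubbardSuperconductivity.HubbardSuperconductivity.Theorems.WeakCouplingBCSWcbcsBcsConstructionLroSeedOfOrderFloor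

/-!
# WeakCouplingBCS / crux `WcbcsBcsConstruction` — the seed ⟷ order-floor dictionary, pointwise in `(U, μ)`

Line `lro-seed-kink-bridge` of crux stmt-HubbardSuperconductivity-2010 (gen-1 lead file, rev L4). For the
grand-canonical Hubbard torus `H = hubbardTorusWith 2 (L+1) 1 U μ` and the `d`-wave pair operator
`O = Δ_d + Δ_d†` (`Δ_d = pairField dWaveFormFactor (L+1)`), call a **seed of strength `ε` at `(U, μ)`** a sequence
of unit, number-definite vectors `Ψ_L` with energy excess `Re⟨Ψ_L, HΨ_L⟩ - E₀(H) = o((L+1)²)` and pair LRO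
`Re⟨Ψ_L, O²Ψ_L⟩ ≥ 4ε²(L+1)⁴` eventually. We PROVE:

* `wcbcs_orderFloor_of_seeds` — seeds of strength `ε > 0` at `(U, μ)`, `U ≥ 0`, force
  `ε ≤ dWaveOrderParameter U μ` (Koma–Tasaki trial state `stub_trialStateBound` at `s_L = 2ε(L+1)²`, the kink
  algebra, and `le_dWaveOrderParameter_of_le_liminf_energyGain`). Rev L3 of the line had this only inside its
  composition and only for `ε = e^{-C/U²}`.
* `wcbcs_seeds_of_orderFloor_half` — conversely (a repackaging of the landed `stub_lroSeedOfOrderFloor`, p76320) an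
  order floor `ε ≤ dWaveOrderParameter U μ` yields seeds of strength `ε/2`.
* `wcbcs_bcsSeedCore_of_orderClause` — hence the crux's conclusion (density-matched `μ` with order floor
  `e^{-C/U²}`, for all `U ∈ (0,U₀)`) implies the rev-L4 core stub `stub_bcsSeedCore` (density-matched `μ` with seeds
  of strength `e^{-(C+1)/U²}`, for all `U ∈ (0, min U₀ 1)`); with `wcbcs_orderFloor_of_seeds` the two are
  EQUIVALENT. (The crux body is spelled out structurally; this file does not import the Theses file.)

Koma–Tasaki, J. Stat. Phys. 76 (1994) 745, Thm 2.2 (trial state) and §1 (order parameter). No definition is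
introduced.
-/

set_option linter.dupNamespace false

namespace Summit.HubbardSuperconductivity.HubbardSuperconductivity.Theorems

open Literature.MathematicalPhysics.QuantumLattice Literature.Probability.LatticeModels Matrix Filter
open scoped Matrix.Norms.L2Operator ComplexOrder Topology

/-- Kink algebra (pure real arithmetic). With `s = 2εL²`, `e = xL²` the trial bound
`E_h ≤ E₀ + e/2 + BK L³√e/s + BK L²/s² - hs` reads
`ε - x/(4h) - BK√x/(4hε) - BK/(8hε²L⁴) ≤ (E₀ - E_h)/(2hL²)`. [folklore] -/
theorem wcbcs_kink_algebra {ε h Lr B K x E₀ Eh : ℝ} (hε : 0 < ε) (hh : 0 < h) (hL : 0 < Lr)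
    (htrial : Eh ≤ E₀ + (x * Lr ^ 2) / 2 + B * K * Lr ^ 3 * Real.sqrt (x * Lr ^ 2) / (2 * ε * Lr ^ 2) +
      B * K * Lr ^ 2 / (2 * ε * Lr ^ 2) ^ 2 - h * (2 * ε * Lr ^ 2)) :
    ε - x / (4 * h) - B * K / (4 * h * ε) * Real.sqrt x - B * K / (8 * h * ε ^ 2 * Lr ^ 4) ≤
      (E₀ - Eh) / (2 * h * Lr ^ 2) := by
  have hsq : Real.sqrt (x * Lr ^ 2) = Real.sqrt x * Lr := by
    rw [Real.sqrt_mul' x (by positivity), Real.sqrt_sq hL.le]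
  rw [hsq] at htrial
  have hpos : 0 < 2 * h * Lr ^ 2 := by positivity
  rw [le_div_iff₀ hpos]
  have h1 : B * K * Lr ^ 3 * (Real.sqrt x * Lr) / (2 * ε * Lr ^ 2) =
      B * K / (4 * h * ε) * Real.sqrt x * (2 * h * Lr ^ 2) := by
    field_simp
    ring
  have h2 : B * K * Lr ^ 2 / (2 * ε * Lr ^ 2) ^ 2 = B * K / (8 * h * ε ^ 2 * Lr ^ 4) * (2 * h * Lr ^ 2) := by
    field_simp
    ring
  have h3 : x * Lr ^ 2 / 2 = x / (4 * h) * (2 * h * Lr ^ 2) := by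
    field_simp
    ring
  have h4 : h * (2 * ε * Lr ^ 2) = ε * (2 * h * Lr ^ 2) := by ring
  rw [h1, h2, h3, h4] at htrial
  nlinarith [htrial]

/-- The remainder of the kink bound tends to `0`: with `x_L → 0`,
`ε - x_L/(4h) - c₁√x_L - c₂ (L+1)⁻⁴ → ε`. [folklore] -/
theorem wcbcs_remainder_tendsto {x : ℕ → ℝ} (hx : Tendsto x atTop (𝓝 0)) (ε h c₁ c₂ : ℝ) :
    Tendsto (fun L : ℕ => ε - x L / (4 * h) - c₁ * Real.sqrt (x L) - c₂ / (((L + 1 : ℕ) : ℝ)) ^ 4)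
      atTop (𝓝 ε) := by
  have h1 : Tendsto (fun L : ℕ => x L / (4 * h)) atTop (𝓝 0) := by
    simpa using hx.div_const (4 * h)
  have h2 : Tendsto (fun L : ℕ => c₁ * Real.sqrt (x L)) atTop (𝓝 0) := by
    have := (Real.continuous_sqrt.tendsto 0).comp hx
    simpa using this.const_mul c₁
  have h3 : Tendsto (fun L : ℕ => c₂ / (((L + 1 : ℕ) : ℝ)) ^ 4) atTop (𝓝 0) := by
    have hL : Tendsto (fun L : ℕ => (((L + 1 : ℕ) : ℝ)) ^ 4) atTop atTop := by
      refine (tendsto_pow_atTop (by norm_num : (4 : ℕ) ≠ 0)).comp ?_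
      exact tendsto_natCast_atTop_atTop.comp (tendsto_add_atTop_nat 1)
    exact (tendsto_const_nhds (x := c₂)).div_atTop hL
  have := ((tendsto_const_nhds (x := ε)).sub h1).sub h2 |>.sub h3
  simpa using this

/-- **Seeds force an order floor, pointwise in `(U, μ)`.** At fixed `(U, μ)` with `U ≥ 0`: if there are unit,
number-definite states `Ψ_L` on the `(L+1)`-tori whose energy excess over the grand-canonical ground energy of
`hubbardTorusWith 2 (L+1) 1 U μ` is `o((L+1)²)` and whose `d`-wave pair LRO is `Re⟨Ψ_L, O²Ψ_L⟩ ≥ 4ε²(L+1)⁴`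
eventually (`O = Δ_d + Δ_d†`), then `ε ≤ dWaveOrderParameter U μ`. The Koma–Tasaki trial state
(`stub_trialStateBound` fed with `stub_hamiltonianNormBound`, `stub_doubleCommutatorBound`; `s_L = 2ε(L+1)²`)
gives at every fixed `h ∈ (0,1)` the linear energy gain `(E(0) - E(h))/(2h(L+1)²) ≥ ε - o(1)`
(`wcbcs_kink_algebra`, `wcbcs_remainder_tendsto`), and `le_dWaveOrderParameter_of_le_liminf_energyGain` converts the
gain into the floor. [cite: KomaTasaki1994, Theorem 2.2] -/
theorem wcbcs_orderFloor_of_seeds (U μ ε : ℝ) (hU : 0 ≤ U) (hε : 0 < ε)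
    (hseed : ∃ (n : ℕ → ℕ) (Ψ : ∀ L : ℕ, Fock (Orb (FermionTorus 2 (L + 1)))),
      (∀ L, star (Ψ L) ⬝ᵥ Ψ L = 1 ∧ IsNParticle (n L) (Ψ L)) ∧
      Tendsto (fun L : ℕ => ((expect (hubbardTorusWith 2 (L + 1) 1 U μ) (Ψ L)).re -
        (hubbardTorusWith 2 (L + 1) 1 U μ).groundEnergy) / ((L + 1 : ℕ) : ℝ) ^ 2) atTop (𝓝 0) ∧
      ∃ L₀ : ℕ, ∀ L : ℕ, L₀ ≤ L → 4 * ε ^ 2 * ((L + 1 : ℕ) : ℝ) ^ 4 ≤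
        (expect ((pairField dWaveFormFactor (L + 1) + (pairField dWaveFormFactor (L + 1))ᴴ) *
          (pairField dWaveFormFactor (L + 1) + (pairField dWaveFormFactor (L + 1))ᴴ)) (Ψ L)).re) :
    ε ≤ dWaveOrderParameter U μ := by
  obtain ⟨n, Ψ, hΨ, hexc, L₀, hlro⟩ := hseed
  obtain ⟨B, hB, htrial⟩ := stub_trialStateBound stub_hamiltonianNormBound stub_doubleCommutatorBound
  set K : ℝ := 1 + U + |μ| with hK_def
  -- the excess energy density `x_L → 0`
  set x : ℕ → ℝ := fun L => ((expect (hubbardTorusWith 2 (L + 1) 1 U μ) (Ψ L)).re -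
      (hubbardTorusWith 2 (L + 1) 1 U μ).groundEnergy) / ((L + 1 : ℕ) : ℝ) ^ 2 with hx_def
  have hx : Tendsto x atTop (𝓝 0) := hexc
  refine le_dWaveOrderParameter_of_le_liminf_energyGain U μ zero_lt_one fun h hh => ?_
  -- lower bound `g_L ≤ f_L` for `L ≥ L₀`
  have hlow : ∀ᶠ L : ℕ in atTop,
      ε - x L / (4 * h) - B * K / (4 * h * ε) * Real.sqrt (x L) - B * K / (8 * h * ε ^ 2) / (((L + 1 : ℕ) : ℝ)) ^ 4 ≤
        ((dWaveSourceTorus (L + 1) U μ 0).groundEnergy - (dWaveSourceTorus (L + 1) U μ h).groundEnergy) /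
          (2 * h * (((L + 1 : ℕ) : ℝ)) ^ 2) := by
    refine eventually_atTop.2 ⟨L₀, fun L hL => ?_⟩
    have hLr : (0 : ℝ) < ((L + 1 : ℕ) : ℝ) := by positivity
    have hs : (0 : ℝ) < 2 * ε * (((L + 1 : ℕ) : ℝ)) ^ 2 := by positivity
    have hseedL := hlro L hL
    have hsq : (2 * ε * (((L + 1 : ℕ) : ℝ)) ^ 2) ^ 2 ≤
        (expect ((pairField dWaveFormFactor (L + 1) + (pairField dWaveFormFactor (L + 1))ᴴ) *
          (pairField dWaveFormFactor (L + 1) + (pairField dWaveFormFactor (L + 1))ᴴ)) (Ψ L)).re := by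
      have : (2 * ε * (((L + 1 : ℕ) : ℝ)) ^ 2) ^ 2 = 4 * ε ^ 2 * (((L + 1 : ℕ) : ℝ)) ^ 4 := by ring
      rw [this]
      exact hseedL
    have key := htrial (L + 1) U μ h (2 * ε * (((L + 1 : ℕ) : ℝ)) ^ 2) hU hh.1.le hs (Ψ L) (n L)
      (hΨ L).1 (hΨ L).2 hsq
    have hxe : (expect (hubbardTorusWith 2 (L + 1) 1 U μ) (Ψ L)).re -
        (hubbardTorusWith 2 (L + 1) 1 U μ).groundEnergy = x L * (((L + 1 : ℕ) : ℝ)) ^ 2 := by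
      simp only [hx_def]
      field_simp
    rw [hxe] at key
    rw [dWaveSourceTorus_zero]
    have := wcbcs_kink_algebra (B := B) (K := K) hε hh.1 hLr key
    have hrw : B * K / (8 * h * ε ^ 2 * (((L + 1 : ℕ) : ℝ)) ^ 4) =
        B * K / (8 * h * ε ^ 2) / (((L + 1 : ℕ) : ℝ)) ^ 4 := by
      rw [div_div]
    rw [hrw] at this
    exact this
  -- the lower bound tends to `ε`
  have hlim := wcbcs_remainder_tendsto hx ε h (B * K / (4 * h * ε)) (B * K / (8 * h * ε ^ 2))
  rw [← hlim.liminf_eq]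
  refine liminf_le_liminf hlow hlim.isBoundedUnder_ge ?_
  exact isCoboundedUnder_ge_of_eventually_le atTop
    (x := 2 * ∑ e ∈ insert (0 : Site 2) unitSteps, |dWaveFormFactor e / Real.sqrt 2|)
    (Eventually.of_forall fun L =>
      (energyGain_div_le_dWaveSourceDensity U μ hh.1).trans (dWaveSourceDensity_le_const _ U μ h))

/-- **Order floor ⇒ seeds of half strength** (the landed converse certificate `stub_lroSeedOfOrderFloor`, p76320,
restated with the seed predicate written exactly as in `wcbcs_orderFloor_of_seeds`, strength `ε/2`).
[cite: KomaTasaki1994, Theorem 2.2] -/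
theorem wcbcs_seeds_of_orderFloor_half (U μ ε : ℝ) (hε : 0 < ε) (hfloor : ε ≤ dWaveOrderParameter U μ) :
    ∃ (n : ℕ → ℕ) (Ψ : ∀ L : ℕ, Fock (Orb (FermionTorus 2 (L + 1)))),
      (∀ L, star (Ψ L) ⬝ᵥ Ψ L = 1 ∧ IsNParticle (n L) (Ψ L)) ∧
      Tendsto (fun L : ℕ => ((expect (hubbardTorusWith 2 (L + 1) 1 U μ) (Ψ L)).re -
        (hubbardTorusWith 2 (L + 1) 1 U μ).groundEnergy) / ((L + 1 : ℕ) : ℝ) ^ 2) atTop (𝓝 0) ∧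
      ∃ L₀ : ℕ, ∀ L : ℕ, L₀ ≤ L → 4 * (ε / 2) ^ 2 * ((L + 1 : ℕ) : ℝ) ^ 4 ≤
        (expect ((pairField dWaveFormFactor (L + 1) + (pairField dWaveFormFactor (L + 1))ᴴ) *
          (pairField dWaveFormFactor (L + 1) + (pairField dWaveFormFactor (L + 1))ᴴ)) (Ψ L)).re :=
  stub_lroSeedOfOrderFloor U μ ε hε hfloor

/-- `e^{-(C+1)/U²} ≤ e^{-C/U²}/2` for `0 < U ≤ 1` (the constant bookkeeping of the converse). [folklore] -/
theorem wcbcs_exp_succ_div_sq_le_half {C U : ℝ} (hUpos : 0 < U) (hU1 : U ≤ 1) :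
    Real.exp (-(C + 1) / U ^ 2) ≤ Real.exp (-C / U ^ 2) / 2 := by
  have hU2 : U ^ 2 ≤ 1 := by nlinarith
  have hU2pos : 0 < U ^ 2 := by positivity
  have h1 : Real.exp (-(C + 1) / U ^ 2) = Real.exp (-C / U ^ 2) * Real.exp (-(1 / U ^ 2)) := by
    rw [← Real.exp_add]; congr 1; field_simp; ring
  have h2 : Real.exp (-(1 / U ^ 2)) ≤ 1 / 2 := by
    have h3 : (1 : ℝ) ≤ 1 / U ^ 2 := by rw [le_div_iff₀ hU2pos]; linarith
    have h4 : Real.exp (-(1 / U ^ 2)) ≤ Real.exp (-1) := Real.exp_le_exp.2 (by linarith)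
    have h5 : Real.exp (-1) ≤ 1 / 2 := by
      have := Real.exp_one_gt_d9
      rw [Real.exp_neg, inv_eq_one_div, div_le_div_iff₀ (Real.exp_pos 1) two_pos]
      linarith
    exact h4.trans h5
  rw [h1]
  have := Real.exp_pos (-C / U ^ 2)
  nlinarith

/-- **The crux's conclusion implies the rev-L4 core stub `stub_bcsSeedCore`** (`U₀ ↦ min U₀ 1`, `C ↦ C + 1`):
if for every `U ∈ (0,U₀)` some `μ` is density-matched at `1 - δ` and carries the order floor
`e^{-C/U²} ≤ dWaveOrderParameter U μ` (this hypothesis is, word for word, the body of crux `WcbcsBcsConstruction`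
after its three leading existentials), then for every `U ∈ (0, min U₀ 1)` some `μ` is density-matched and carries
seeds of strength `e^{-(C+1)/U²}`. With `wcbcs_orderFloor_of_seeds` (seeds ⇒ floor, same `μ`) the core stub and the
crux are EQUIVALENT: the line `lro-seed-kink-bridge` is a dictionary, complete modulo the crux itself.
[cite: KomaTasaki1994, Theorem 2.2] -/
theorem wcbcs_bcsSeedCore_of_orderClause {δ U₀ C : ℝ}
    (hcrux : ∀ U ∈ Set.Ioo (0:ℝ) U₀, ∃ μ : ℝ,
      Filter.Tendsto (fun L : ℕ => ((hubbardTorusWith 2 (L + 1) 1 U μ).groundStateFunctional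
        totalNumber).re / ((L + 1 : ℕ) : ℝ) ^ 2) Filter.atTop (nhds (1 - δ)) ∧
      Real.exp (-C / U ^ 2) ≤ dWaveOrderParameter U μ) :
    ∀ U ∈ Set.Ioo (0:ℝ) (min U₀ 1), ∃ μ : ℝ,
      Filter.Tendsto (fun L : ℕ => ((hubbardTorusWith 2 (L + 1) 1 U μ).groundStateFunctional
        totalNumber).re / ((L + 1 : ℕ) : ℝ) ^ 2) Filter.atTop (nhds (1 - δ)) ∧
      ∃ (n : ℕ → ℕ) (Ψ : ∀ L : ℕ, Fock (Orb (FermionTorus 2 (L + 1)))),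
        (∀ L, star (Ψ L) ⬝ᵥ Ψ L = 1 ∧ IsNParticle (n L) (Ψ L)) ∧
        Tendsto (fun L : ℕ => ((expect (hubbardTorusWith 2 (L + 1) 1 U μ) (Ψ L)).re -
          (hubbardTorusWith 2 (L + 1) 1 U μ).groundEnergy) / ((L + 1 : ℕ) : ℝ) ^ 2) atTop (𝓝 0) ∧
        ∃ L₀ : ℕ, ∀ L : ℕ, L₀ ≤ L → 4 * Real.exp (-(C + 1) / U ^ 2) ^ 2 * ((L + 1 : ℕ) : ℝ) ^ 4 ≤
          (expect ((pairField dWaveFormFactor (L + 1) + (pairField dWaveFormFactor (L + 1))ᴴ) *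
            (pairField dWaveFormFactor (L + 1) + (pairField dWaveFormFactor (L + 1))ᴴ)) (Ψ L)).re := by
  intro U hU
  obtain ⟨μ, hdens, hfloor⟩ := hcrux U ⟨hU.1, lt_of_lt_of_le hU.2 (min_le_left _ _)⟩
  refine ⟨μ, hdens, ?_⟩
  obtain ⟨n, Ψ, hΨ, hexc, L₀, hlro⟩ :=
    wcbcs_seeds_of_orderFloor_half U μ (Real.exp (-C / U ^ 2)) (Real.exp_pos _) hfloor
  refine ⟨n, Ψ, hΨ, hexc, L₀, fun L hL => le_trans ?_ (hlro L hL)⟩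
  have hkey := wcbcs_exp_succ_div_sq_le_half (C := C) hU.1 (lt_of_lt_of_le hU.2 (min_le_right _ _)).le
  have hsq : Real.exp (-(C + 1) / U ^ 2) ^ 2 ≤ (Real.exp (-C / U ^ 2) / 2) ^ 2 :=
    pow_le_pow_left₀ (Real.exp_pos _).le hkey 2
  have hL4 : (0 : ℝ) ≤ ((L + 1 : ℕ) : ℝ) ^ 4 := by positivity
  nlinarith [mul_le_mul_of_nonneg_right hsq hL4]

/-- **Registered form** (`stub_orderFloorOfSeeds` of crux stmt-HubbardSuperconductivity-2010): seeds of strength `ε` at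
`(U, μ)` force `ε ≤ dWaveOrderParameter U μ` — `wcbcs_orderFloor_of_seeds` with the hypotheses as arrows.
[cite: KomaTasaki1994, Theorem 2.2] -/
theorem stub_orderFloorOfSeeds : ∀ (U μ ε : ℝ), 0 ≤ U → 0 < ε → (∃ (n : ℕ → ℕ) (Ψ : ∀ L : ℕ, Fock (Orb (FermionTorus 2 (L + 1)))), (∀ L, star (Ψ L) ⬝ᵥ Ψ L = 1 ∧ IsNParticle (n L) (Ψ L)) ∧ Tendsto (fun L : ℕ => ((expect (hubbardTorusWith 2 (L + 1) 1 U μ) (Ψ L)).re - (hubbardTorusWith 2 (L + 1) 1 U μ).groundEnergy) / ((L + 1 : ℕ) : ℝ) ^ 2) atTop (𝓝 0) ∧ ∃ L₀ : ℕ, ∀ L : ℕ, L₀ ≤ L → 4 * ε ^ 2 * ((L + 1 : ℕ) : ℝ) ^ 4 ≤ (expect ((pairField dWaveFormFactor (L + 1) + (pairField dWaveFormFactor (L + 1))ᴴ) * (pairField dWaveFormFactor (L + 1) + (pairField dWaveFormFactor (L + 1))ᴴ)) (Ψ L)).re) → ε ≤ dWaveOrderParameter U μ :=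
  fun U μ ε hU hε hseed => wcbcs_orderFloor_of_seeds U μ ε hU hε hseed

end Summit.HubbardSuperconductivity.HubbardSuperconductivity.Theorems
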